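import Summits.Ventures.HodgeRepro2.T5SL2Unimodular
import Summits.Ventures.HodgeRepro2.T5CayleySU11

/-!
# `SU(1,1)` is perfect and unimodular

`SU(1,1) = {g ∈ SL₂(ℂ) : gᴴ J g = J}` (`J = diag(1, -1)`, `T5UnitaryBound.MemU11`) is realised
here as the RANGE of the Cayley homomorphism `SL₂(ℝ) →* SL₂(ℂ)`, `g ↦ C g C⁻¹`
(`T5CayleySU11.cayleyConj`; `exists_real_of_memU11_det_one` and `memU11_cayleyConj_real` are the
two inclusions).  Hence `SU(1,1)` is a surjective image of the perfect group `SL₂(ℝ)`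
(`T5SL2Perfect`), so it is perfect; it is a closed subgroup of the locally compact second
countable `SL₂(ℂ)`, so it is a locally compact second countable group; and therefore
(`T5UnimodularPerfect`) its modular character is trivial and every left Haar measure on it is
right-invariant and inversion-invariant — the support map's «`SU(1,1)` is unimodular» (N4.3 / B1)
for the cell's own group.  Rühl's NORMALISATION of the Haar measure is not in this file.

Blind lane: Mathlib + own prefix only; no sorry; axioms ⊆ {propext, Classical.choice, Quot.sound}.
-/

namespace Summit.Ventures.HodgeRepro2.T5SU11Unimodular

open MeasureTheory MeasureTheory.Measure Matrix Topology T5CayleySU11 T5UnitaryBound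

/-- Conjugation by the Cayley matrix as a homomorphism `SL₂(ℂ) →* SL₂(ℂ)`
(`det (C g C⁻¹) = det g`). -/
noncomputable def cayleySL : SpecialLinearGroup (Fin 2) ℂ →* SpecialLinearGroup (Fin 2) ℂ where
  toFun g := ⟨cayleyConj (g : Matrix (Fin 2) (Fin 2) ℂ), by
    rw [det_cayleyConj, Matrix.SpecialLinearGroup.det_coe]⟩
  map_one' := Subtype.ext (by simp [cayleyConj_one])
  map_mul' g h := Subtype.ext (by simp [cayleyConj_mul])

/-- The matrix of `cayleySL g` is `cayleyConj g`. -/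
@[simp] lemma coe_cayleySL (g : SpecialLinearGroup (Fin 2) ℂ) :
    ((cayleySL g : SpecialLinearGroup (Fin 2) ℂ) : Matrix (Fin 2) (Fin 2) ℂ) =
      cayleyConj (g : Matrix (Fin 2) (Fin 2) ℂ) :=
  rfl

/-- The Cayley homomorphism `SL₂(ℝ) →* SL₂(ℂ)`: `g ↦ C (g ⊗ ℂ) C⁻¹`. -/
noncomputable def cayleyHom : SpecialLinearGroup (Fin 2) ℝ →* SpecialLinearGroup (Fin 2) ℂ :=
  cayleySL.comp (SpecialLinearGroup.map Complex.ofRealHom)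

/-- The matrix of `cayleyHom g`. -/
lemma coe_cayleyHom (g : SpecialLinearGroup (Fin 2) ℝ) :
    ((cayleyHom g : SpecialLinearGroup (Fin 2) ℂ) : Matrix (Fin 2) (Fin 2) ℂ) =
      cayleyConj ((g : Matrix (Fin 2) (Fin 2) ℝ).map Complex.ofReal) :=
  rfl

/-- A real `2 × 2` matrix, complexified, in the `!![↑p, ↑q; ↑r, ↑s]` form. -/
lemma map_ofReal_eq (A : Matrix (Fin 2) (Fin 2) ℝ) :
    A.map Complex.ofReal = !![(A 0 0 : ℂ), A 0 1; A 1 0, A 1 1] := by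
  ext i j
  fin_cases i <;> fin_cases j <;> simp

/-- `SU(1,1) ⊂ SL₂(ℂ)`, realised as the range of the Cayley homomorphism. -/
noncomputable def SU11 : Subgroup (SpecialLinearGroup (Fin 2) ℂ) := cayleyHom.range

/-- **`SU(1,1)` is the group `{g ∈ SL₂(ℂ) : gᴴ J g = J}`**: membership in the range of the Cayley
homomorphism is exactly `MemU11`. -/
theorem mem_SU11_iff (g : SpecialLinearGroup (Fin 2) ℂ) :
    g ∈ SU11 ↔ MemU11 (g : Matrix (Fin 2) (Fin 2) ℂ) := by
  constructor
  · rintro ⟨h, rfl⟩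
    rw [coe_cayleyHom, map_ofReal_eq]
    apply memU11_cayleyConj_real
    have := Matrix.SpecialLinearGroup.det_coe h
    rw [Matrix.det_fin_two] at this
    exact this
  · intro hg
    obtain ⟨p, q, r, s, hdet, hg'⟩ :=
      exists_real_of_memU11_det_one hg (Matrix.SpecialLinearGroup.det_coe g)
    refine ⟨⟨!![p, q; r, s], by simp [Matrix.det_fin_two_of, hdet]⟩, Subtype.ext ?_⟩
    show cayleyConj ((!![p, q; r, s] : Matrix (Fin 2) (Fin 2) ℝ).map Complex.ofReal) =
      (g : Matrix (Fin 2) (Fin 2) ℂ)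
    rw [map_ofReal_eq, hg']
    simp

/-- **`SU(1,1)` is perfect**: the surjective image of the perfect group `SL₂(ℝ)`. -/
theorem commutator_SU11_eq_top : commutator SU11 = ⊤ := by
  have hs : Function.Surjective cayleyHom.rangeRestrict :=
    MonoidHom.rangeRestrict_surjective cayleyHom
  have h := map_commutator_eq (Matrix.SpecialLinearGroup (Fin 2) ℝ) cayleyHom.rangeRestrict
  rw [T5SL2Perfect.commutator_eq_top_real, Subgroup.map_top_of_surjective _ hs,
    MonoidHom.range_eq_top_of_surjective _ hs] at h
  rw [commutator_def]
  exact h.symm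

/-- `SU(1,1)` is closed in `SL₂(ℂ)`: it is the fibre of the continuous map `g ↦ gᴴ J g` over
`J`. -/
theorem isClosed_SU11 : IsClosed (SU11 : Set (SpecialLinearGroup (Fin 2) ℂ)) := by
  have h : (SU11 : Set (SpecialLinearGroup (Fin 2) ℂ)) =
      (fun g : SpecialLinearGroup (Fin 2) ℂ =>
        (g : Matrix (Fin 2) (Fin 2) ℂ)ᴴ * T5UnitaryBound.J * (g : Matrix (Fin 2) (Fin 2) ℂ)) ⁻¹'
        {T5UnitaryBound.J} := by
    ext g
    simp only [SetLike.mem_coe, mem_SU11_iff, MemU11, Set.mem_preimage, Set.mem_singleton_iff]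
  rw [h]
  exact isClosed_singleton.preimage
    ((continuous_subtype_val.matrix_conjTranspose.matrix_mul continuous_const).matrix_mul
      continuous_subtype_val)

/-- `SU(1,1)` is locally compact (closed in the locally compact `SL₂(ℂ)`). -/
instance instLocallyCompactSpaceSU11 : LocallyCompactSpace SU11 :=
  isClosed_SU11.isClosedEmbedding_subtypeVal.locallyCompactSpace

/-- `SU(1,1)` is second countable (a subspace of `SL₂(ℂ)`). -/
instance instSecondCountableTopologySU11 : SecondCountableTopology SU11 :=
  isClosed_SU11.isClosedEmbedding_subtypeVal.isEmbedding.secondCountableTopology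

section general

open scoped ENNReal

variable {G : Type*} [Group G] [TopologicalSpace G] [IsTopologicalGroup G] [LocallyCompactSpace G]
  [SecondCountableTopology G] [MeasurableSpace G] [BorelSpace G]

/-- **Unimodular ⇒ inversion-invariant**, second countable form (no regularity hypothesis):
the argument of `T5UnimodularPerfect.isInvInvariant_of_isMulRightInvariant` with the second
countable uniqueness `isMulLeftInvariant_eq_smul`. -/
theorem isInvInvariant_of_isMulRightInvariant_of_secondCountable (μ : Measure G) [IsHaarMeasure μ]
    [IsMulRightInvariant μ] : IsInvInvariant μ := by
  constructor
  let c : ℝ≥0∞ := haarScalarFactor μ.inv μ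
  have hc : μ.inv = c • μ := isMulLeftInvariant_eq_smul μ.inv μ
  have : map Inv.inv (map Inv.inv μ) = c ^ 2 • μ := by
    rw [← inv_def μ, hc, Measure.map_smul, ← inv_def μ, hc, smul_smul, pow_two]
  have μeq : μ = c ^ 2 • μ := by
    rw [map_map continuous_inv.measurable continuous_inv.measurable] at this
    simpa only [inv_involutive, Function.Involutive.comp_self, Measure.map_id]
  have K : TopologicalSpace.PositiveCompacts G := Classical.arbitrary _
  have : c ^ 2 * μ K = 1 ^ 2 * μ K := by
    conv_rhs => rw [μeq]
    simp
  have : c ^ 2 = 1 ^ 2 :=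
    (ENNReal.mul_left_inj (measure_pos_of_nonempty_interior _ K.interior_nonempty).ne'
          K.isCompact.measure_lt_top.ne).1 this
  have : c = 1 := (ENNReal.pow_right_strictMono two_ne_zero).injective this
  rw [hc, this, one_smul]

end general

/-- **The modular character of `SU(1,1)` is trivial.** -/
theorem modularCharacterFun_eq_one (g : SU11) : modularCharacterFun g = 1 :=
  T5UnimodularPerfect.modularCharacterFun_eq_one_of_commutator_eq_top commutator_SU11_eq_top g

/-- `modularCharacter = 1` on `SU(1,1)`. -/
theorem modularCharacter_eq_one : (modularCharacter : SU11 →* NNReal) = 1 :=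
  T5UnimodularPerfect.modularCharacter_eq_one_of_commutator_eq_top commutator_SU11_eq_top

variable [MeasurableSpace SU11] [BorelSpace SU11]

/-- **`SU(1,1)` is unimodular**: every left Haar measure on it is right-invariant (second
countable, so no regularity hypothesis). -/
theorem isMulRightInvariant (μ : Measure SU11) [IsHaarMeasure μ] : IsMulRightInvariant μ :=
  T5UnimodularPerfect.isMulRightInvariant_of_commutator_eq_top_of_secondCountable
    commutator_SU11_eq_top μ

/-- Every left Haar measure on `SU(1,1)` is inversion-invariant. -/
theorem isInvInvariant (μ : Measure SU11) [IsHaarMeasure μ] : IsInvInvariant μ :=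
  haveI := isMulRightInvariant μ
  isInvInvariant_of_isMulRightInvariant_of_secondCountable μ

/-- `∫ f (x * g) ∂μ = ∫ f x ∂μ` on `SU(1,1)`. -/
theorem integral_mul_right (μ : Measure SU11) [IsHaarMeasure μ] {E : Type*} [NormedAddCommGroup E]
    [NormedSpace ℝ E] (f : SU11 → E) (g : SU11) : ∫ x, f (x * g) ∂μ = ∫ x, f x ∂μ :=
  haveI := isMulRightInvariant μ
  integral_mul_right_eq_self f g

/-- `∫ f x⁻¹ ∂μ = ∫ f x ∂μ` on `SU(1,1)`. -/
theorem integral_inv (μ : Measure SU11) [IsHaarMeasure μ] {E : Type*} [NormedAddCommGroup E]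
    [NormedSpace ℝ E] (f : SU11 → E) : ∫ x, f x⁻¹ ∂μ = ∫ x, f x ∂μ :=
  haveI := isInvInvariant μ
  integral_inv_eq_self f μ

end Summit.Ventures.HodgeRepro2.T5SU11Unimodular
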